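import Mathlib
import HarnessLib
import Summits.Ventures.LatticeQCDFlow.Exactness.FTHMCKernelCovariance
import Summits.Ventures.LatticeQCDFlow.Exactness.GaugeFTHMCSymmetricWord

/-!
# Gauge-link FT-HMC with ANY proposal commuting with `θ × R` — palindromic splitting words, OMF2, OMF4 — inherits the symmetries of its data

HONEST FRAMING: exact (Metropolis-corrected) sampling algorithms for lattice gauge theory;
figures of merit are autocorrelation/cost numbers at stated couplings and volumes; no
continuum-physics claim.

Venture `LatticeQCDFlow` (cell pub-lqcd), topic `Exactness`; FANOUT row 14 (`eng-flowhmc`, engine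
`latflow.fthmc`, integrator menu `leapfrog | omf2 | omf4` = row 9's `leapfrog`, `omf2Word`,
`omf4Word` / `palindromicWord` of `SplittingWords.lean`).  NEW WORK of the cell; nothing is cited
as a fact; no number.  `FTHMCKernelCovariance.gauge_fthmc_conjKernel_eq_self` typed the symmetry
of the FT-HMC configuration kernel for the LEAPFROG proposal; the engine also runs OMF2 / OMF4.
This file removes the dependence on the integrator:

* §1 (algebra, any `Ω`): products of maps commuting with `T` commute with `T`
  (`commute_list_prod`), hence every palindromic word `A₁ ⋯ A_k X A_k ⋯ A₁`
  (`commute_palindromicWord`) and `flip ∘ word^n` (`commute_flip_palindromicWord_pow`, `R` odd);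
  on the gauge phase space: the OMF2 word `K_{g₁} D_e K_{g₂} D_e K_{g₁}` and the OMF4 word (three
  group drifts, three forces) commute with `θ × R` when `R` is additive, every drift is covariant
  and every force is covariant (`commute_omf2Word_prodMap`, `commute_omf4Word_prodMap`);
* §2 **`gauge_fthmc_conjKernel_eq_self_of_commute`** — for ANY measurable proposal `Φ` commuting
  with `Θ × R` (with `F ∘ Θ = Θ ∘ F`, `S ∘ Θ = S`, `J ∘ Θ = J`, `T ∘ R = T`, `R_* ν = ν`), the
  reported kernel `F ∘ (refresh; involMH Φ H̃; forget) ∘ F⁻¹` commutes with `Θ`; corollaries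
  **`gauge_fthmc_palindromicWord_conjKernel_eq_self`**, **`gauge_fthmc_omf2_conjKernel_eq_self`**,
  **`gauge_fthmc_omf4_conjKernel_eq_self`** (the kernels of `GaugeFTHMCSymmetricWord`, any
  measurability certificate `hΦ`).

The `SU(2)` instantiation (gauge transformations, `R_h = Ad_h`) is the sequel
`SU2FTHMCIntegratorsCovariance.lean`.

NOT CLAIMED: anything about a concrete group or force routine; any number.
-/

noncomputable section

namespace Summit.Ventures.LatticeQCDFlow.Exactness

open Set MeasureTheory ProbabilityTheory ProbabilityTheory.Kernel
open scoped ENNReal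

/-! ## §1 Words of commuting maps commute -/

section Words

variable {Ω : Type*}

/-- A product of permutations each commuting with `T` commutes with `T`. -/
theorem commute_list_prod {T : Ω → Ω} :
    ∀ L : List (Equiv.Perm Ω), (∀ A ∈ L, Function.Commute (⇑A) T) → Function.Commute (⇑L.prod) T
  | [], _ => by
      rw [List.prod_nil, Equiv.Perm.coe_one]
      exact Function.Commute.id_left
  | A :: L, hL => by
      rw [List.prod_cons, Equiv.Perm.coe_mul]
      exact (hL A List.mem_cons_self).comp_left
        (commute_list_prod L fun B hB => hL B (List.mem_cons_of_mem _ hB))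

/-- A palindromic word `A₁ ⋯ A_k X A_k ⋯ A₁` of maps commuting with `T` commutes with `T`. -/
theorem commute_palindromicWord {T : Ω → Ω} {L : List (Equiv.Perm Ω)} {X : Equiv.Perm Ω}
    (hL : ∀ A ∈ L, Function.Commute (⇑A) T) (hX : Function.Commute (⇑X) T) :
    Function.Commute (⇑(palindromicWord L X)) T := by
  unfold palindromicWord
  rw [Equiv.Perm.coe_mul, Equiv.Perm.coe_mul]
  exact ((commute_list_prod L hL).comp_left hX).comp_left
    (commute_list_prod L.reverse fun A hA => hL A (List.mem_reverse.1 hA))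

variable {Q P : Type*}

/-- `flip ∘ word^n` commutes with `θ × R` when the stages do and `R` is odd. -/
theorem commute_flip_palindromicWord_pow [AddCommGroup P] (θ : Q → Q) {R : P → P}
    (hRneg : ∀ p, R (-p) = -R p) {L : List (Equiv.Perm (Q × P))} {X : Equiv.Perm (Q × P)}
    (hL : ∀ A ∈ L, Function.Commute (⇑A) (fun z : Q × P => (θ z.1, R z.2)))
    (hX : Function.Commute (⇑X) (fun z : Q × P => (θ z.1, R z.2))) (n : ℕ) :
    Function.Commute (⇑((flip : Equiv.Perm (Q × P)) * palindromicWord L X ^ n))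
      (fun z : Q × P => (θ z.1, R z.2)) := by
  rw [Equiv.Perm.coe_mul, Equiv.Perm.coe_pow]
  exact (commute_flip_prodMap θ hRneg).comp_left ((commute_palindromicWord hL hX).iterate_left n)

/-- **The OMF2 word `K_{g₁} D_e K_{g₂} D_e K_{g₁}` commutes with `θ × R`** — `R` additive, drift
covariant, both forces covariant. -/
theorem commute_omf2Word_prodMap [Group Q] [AddCommGroup P] {e : P → Q} {g₁ g₂ : Q → P}
    {θ : Q → Q} {R : P → P} (hRadd : ∀ p p', R (p + p') = R p + R p')
    (he : ∀ p q, e (R p) * θ q = θ (e p * q)) (hg₁ : ∀ q, g₁ (θ q) = R (g₁ q))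
    (hg₂ : ∀ q, g₂ (θ q) = R (g₂ q)) :
    Function.Commute (⇑(omf2Word g₁ (mulDrift e) g₂)) (fun z : Q × P => (θ z.1, R z.2)) := by
  unfold omf2Word
  refine commute_palindromicWord (fun A hA => ?_) (commute_kick_prodMap hRadd hg₂)
  simp only [List.mem_cons, List.mem_nil_iff, or_false] at hA
  rcases hA with rfl | rfl
  · exact commute_kick_prodMap hRadd hg₁
  · exact commute_drift_mulDrift_prodMap he

/-- **The OMF4 word (11 stages: three group drifts `e₁ e₂ e₃`, three forces `gᵥ gₗ g_c`) commutes
with `θ × R`** — `R` additive, every drift covariant, every force covariant. -/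
theorem commute_omf4Word_prodMap [Group Q] [AddCommGroup P] {e₁ e₂ e₃ : P → Q}
    {gᵥ gₗ g_c : Q → P} {θ : Q → Q} {R : P → P} (hRadd : ∀ p p', R (p + p') = R p + R p')
    (he₁ : ∀ p q, e₁ (R p) * θ q = θ (e₁ p * q)) (he₂ : ∀ p q, e₂ (R p) * θ q = θ (e₂ p * q))
    (he₃ : ∀ p q, e₃ (R p) * θ q = θ (e₃ p * q)) (hgᵥ : ∀ q, gᵥ (θ q) = R (gᵥ q))
    (hgₗ : ∀ q, gₗ (θ q) = R (gₗ q)) (hg_c : ∀ q, g_c (θ q) = R (g_c q)) :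
    Function.Commute (⇑(omf4Word gᵥ (mulDrift e₁) gₗ (mulDrift e₂) g_c (mulDrift e₃)))
      (fun z : Q × P => (θ z.1, R z.2)) := by
  unfold omf4Word
  refine commute_palindromicWord (fun A hA => ?_) (commute_drift_mulDrift_prodMap he₃)
  simp only [List.mem_cons, List.mem_nil_iff, or_false] at hA
  rcases hA with rfl | rfl | rfl | rfl | rfl
  · exact commute_kick_prodMap hRadd hgᵥ
  · exact commute_drift_mulDrift_prodMap he₁
  · exact commute_kick_prodMap hRadd hgₗ
  · exact commute_drift_mulDrift_prodMap he₂
  · exact commute_kick_prodMap hRadd hg_c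

end Words

/-! ## §2 The reported FT-HMC kernel with any commuting proposal inherits the symmetry -/

section Kernel

variable {Q P : Type*} [MeasurableSpace Q] [MeasurableSpace P]

/-- **FT-HMC with ANY measurable proposal commuting with `Θ × R` inherits the symmetry.**  Momenta
with reference `ν` and kinetic term `T`, member `F : Q ≃ᵐ Q` with booked density `J`, action `S`,
proposal `Φ` (ANY measurable map of phase space — leapfrog^n, OMF words, …, with any measurability
certificate `hΦ`); if `Φ ∘ (Θ × R) = (Θ × R) ∘ Φ`, `F ∘ Θ = Θ ∘ F`, `S ∘ Θ = S`, `J ∘ Θ = J`,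
`T ∘ R = T` and `R_* ν = ν`, then `K = F ∘ (refresh π ∼ Z⁻¹e^{−T}ν; involMH Φ H̃; forget) ∘ F⁻¹`
satisfies `conjKernel K Θ = K`. -/
theorem gauge_fthmc_conjKernel_eq_self_of_commute {ν : Measure P} [SFinite ν]
    {Φ : Q × P → Q × P} {hΦ : Measurable Φ} {S : Q → ℝ} (hS : Measurable S) {T : P → ℝ}
    (hT : Measurable T) (F : Q ≃ᵐ Q) {J : Q → ℝ} (hJm : Measurable J) (Θ : Q ≃ᵐ Q) (R : P ≃ᵐ P)
    (hcomm : Function.Commute Φ (fun z : Q × P => (Θ z.1, R z.2)))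
    (hFΘ : ∀ q, F (Θ q) = Θ (F q)) (hSΘ : ∀ q, S (Θ q) = S q) (hJΘ : ∀ q, J (Θ q) = J q)
    (hTR : ∀ p, T (R p) = T p) (hRν : MeasurePreserving R ν ν) :
    conjKernel
      (conjKernel
        (refreshUpdate (involMH Φ hΦ fun z : Q × P => (S (F z.1) - Real.log (J z.1)) + T z.2)
          ((ν.withDensity (fun q => ENNReal.ofReal (Real.exp (-T q))) Set.univ)⁻¹ •
            ν.withDensity fun q => ENNReal.ofReal (Real.exp (-T q))))
        F) Θ =
      conjKernel
        (refreshUpdate (involMH Φ hΦ fun z : Q × P => (S (F z.1) - Real.log (J z.1)) + T z.2)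
          ((ν.withDensity (fun q => ENNReal.ofReal (Real.exp (-T q))) Set.univ)⁻¹ •
            ν.withDensity fun q => ENNReal.ofReal (Real.exp (-T q))))
        F := by
  have hH : Measurable fun z : Q × P => (S (F z.1) - Real.log (J z.1)) + T z.2 :=
    (((hS.comp F.measurable).sub (Real.measurable_log.comp hJm)).comp measurable_fst).add
      (hT.comp measurable_snd)
  have hf : Measurable fun q : P => ENNReal.ofReal (Real.exp (-T q)) :=
    ENNReal.measurable_ofReal.comp (Real.measurable_exp.comp hT.neg)
  have hR : (((ν.withDensity (fun q => ENNReal.ofReal (Real.exp (-T q))) Set.univ)⁻¹ •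
      ν.withDensity fun q => ENNReal.ofReal (Real.exp (-T q))).map R) =
      (ν.withDensity (fun q => ENNReal.ofReal (Real.exp (-T q))) Set.univ)⁻¹ •
        ν.withDensity fun q => ENNReal.ofReal (Real.exp (-T q)) := by
    rw [Measure.map_smul, map_withDensity_eq_of_measurePreserving R hRν hf (fun p => by rw [hTR])]
  refine thmc_conjKernel_eq_self hH _ F Θ R (fun z => hcomm z) (fun z => ?_) hR ?_
  · change (S (F (Θ z.1)) - Real.log (J (Θ z.1))) + T (R z.2) = (S (F z.1) - Real.log (J z.1)) + T z.2
    rw [hFΘ, hSΘ, hJΘ, hTR]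
  · exact MeasurableEquiv.ext (funext fun q => hFΘ q)

/-- **Gauge-link FT-HMC with ANY palindromic splitting word inherits the symmetries of its data**
(stages `A ∈ L` and centre `X` commuting with `Θ × R`, `R` odd; any `n`; the kernel of
`GaugeFTHMCSymmetricWord.gauge_fthmc_palindromicWord_config_exact` with any measurability
certificate). -/
theorem gauge_fthmc_palindromicWord_conjKernel_eq_self [AddCommGroup P] {ν : Measure P} [SFinite ν]
    {L : List (Equiv.Perm (Q × P))} {X : Equiv.Perm (Q × P)} (n : ℕ)
    {hΦ : Measurable (⇑((flip : Equiv.Perm (Q × P)) * palindromicWord L X ^ n))}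
    {S : Q → ℝ} (hS : Measurable S) {T : P → ℝ} (hT : Measurable T) (F : Q ≃ᵐ Q) {J : Q → ℝ}
    (hJm : Measurable J) (Θ : Q ≃ᵐ Q) (R : P ≃ᵐ P) (hRneg : ∀ p, R (-p) = -R p)
    (hL : ∀ A ∈ L, Function.Commute (⇑A) (fun z : Q × P => (Θ z.1, R z.2)))
    (hX : Function.Commute (⇑X) (fun z : Q × P => (Θ z.1, R z.2)))
    (hFΘ : ∀ q, F (Θ q) = Θ (F q)) (hSΘ : ∀ q, S (Θ q) = S q) (hJΘ : ∀ q, J (Θ q) = J q)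
    (hTR : ∀ p, T (R p) = T p) (hRν : MeasurePreserving R ν ν) :
    conjKernel
      (conjKernel
        (refreshUpdate
          (involMH (⇑((flip : Equiv.Perm (Q × P)) * palindromicWord L X ^ n)) hΦ
            fun z : Q × P => (S (F z.1) - Real.log (J z.1)) + T z.2)
          ((ν.withDensity (fun q => ENNReal.ofReal (Real.exp (-T q))) Set.univ)⁻¹ •
            ν.withDensity fun q => ENNReal.ofReal (Real.exp (-T q))))
        F) Θ =
      conjKernel
        (refreshUpdate
          (involMH (⇑((flip : Equiv.Perm (Q × P)) * palindromicWord L X ^ n)) hΦ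
            fun z : Q × P => (S (F z.1) - Real.log (J z.1)) + T z.2)
          ((ν.withDensity (fun q => ENNReal.ofReal (Real.exp (-T q))) Set.univ)⁻¹ •
            ν.withDensity fun q => ENNReal.ofReal (Real.exp (-T q))))
        F :=
  gauge_fthmc_conjKernel_eq_self_of_commute hS hT F hJm Θ R
    (commute_flip_palindromicWord_pow (⇑Θ) hRneg hL hX n) hFΘ hSΘ hJΘ hTR hRν

/-- **Gauge-link FT-HMC with the OMF2 integrator inherits the symmetries of its data**: group
drift `e` covariant, forces `g₁ g₂` covariant, `R` additive and odd (the kernel of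
`gauge_fthmc_omf2_config_exact`, any measurability certificate). -/
theorem gauge_fthmc_omf2_conjKernel_eq_self [Group Q] [AddCommGroup P] {ν : Measure P} [SFinite ν] {e : P → Q}
    {g₁ g₂ : Q → P} (n : ℕ)
    {hΦ : Measurable (⇑((flip : Equiv.Perm (Q × P)) * omf2Word g₁ (mulDrift e) g₂ ^ n))}
    {S : Q → ℝ} (hS : Measurable S) {T : P → ℝ} (hT : Measurable T) (F : Q ≃ᵐ Q) {J : Q → ℝ}
    (hJm : Measurable J) (Θ : Q ≃ᵐ Q) (R : P ≃ᵐ P) (hRneg : ∀ p, R (-p) = -R p)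
    (hRadd : ∀ p p', R (p + p') = R p + R p') (he : ∀ p q, e (R p) * Θ q = Θ (e p * q))
    (hg₁ : ∀ q, g₁ (Θ q) = R (g₁ q)) (hg₂ : ∀ q, g₂ (Θ q) = R (g₂ q))
    (hFΘ : ∀ q, F (Θ q) = Θ (F q)) (hSΘ : ∀ q, S (Θ q) = S q) (hJΘ : ∀ q, J (Θ q) = J q)
    (hTR : ∀ p, T (R p) = T p) (hRν : MeasurePreserving R ν ν) :
    conjKernel
      (conjKernel
        (refreshUpdate
          (involMH (⇑((flip : Equiv.Perm (Q × P)) * omf2Word g₁ (mulDrift e) g₂ ^ n)) hΦ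
            fun z : Q × P => (S (F z.1) - Real.log (J z.1)) + T z.2)
          ((ν.withDensity (fun q => ENNReal.ofReal (Real.exp (-T q))) Set.univ)⁻¹ •
            ν.withDensity fun q => ENNReal.ofReal (Real.exp (-T q))))
        F) Θ =
      conjKernel
        (refreshUpdate
          (involMH (⇑((flip : Equiv.Perm (Q × P)) * omf2Word g₁ (mulDrift e) g₂ ^ n)) hΦ
            fun z : Q × P => (S (F z.1) - Real.log (J z.1)) + T z.2)
          ((ν.withDensity (fun q => ENNReal.ofReal (Real.exp (-T q))) Set.univ)⁻¹ •
            ν.withDensity fun q => ENNReal.ofReal (Real.exp (-T q))))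
        F := by
  have hcomm : Function.Commute (⇑((flip : Equiv.Perm (Q × P)) * omf2Word g₁ (mulDrift e) g₂ ^ n))
      (fun z : Q × P => (Θ z.1, R z.2)) := by
    rw [Equiv.Perm.coe_mul, Equiv.Perm.coe_pow]
    exact (commute_flip_prodMap (⇑Θ) hRneg).comp_left
      ((commute_omf2Word_prodMap hRadd he hg₁ hg₂).iterate_left n)
  exact gauge_fthmc_conjKernel_eq_self_of_commute hS hT F hJm Θ R hcomm hFΘ hSΘ hJΘ hTR hRν

/-- **Gauge-link FT-HMC with the OMF4 integrator inherits the symmetries of its data**: three group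
drifts `e₁ e₂ e₃` covariant, three forces `gᵥ gₗ g_c` covariant, `R` additive and odd (the kernel of
`gauge_fthmc_omf4_config_exact`, any measurability certificate). -/
theorem gauge_fthmc_omf4_conjKernel_eq_self [Group Q] [AddCommGroup P] {ν : Measure P} [SFinite ν]
    {e₁ e₂ e₃ : P → Q}
    {gᵥ gₗ g_c : Q → P} (n : ℕ)
    {hΦ : Measurable (⇑((flip : Equiv.Perm (Q × P)) *
      omf4Word gᵥ (mulDrift e₁) gₗ (mulDrift e₂) g_c (mulDrift e₃) ^ n))}
    {S : Q → ℝ} (hS : Measurable S) {T : P → ℝ} (hT : Measurable T) (F : Q ≃ᵐ Q) {J : Q → ℝ}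
    (hJm : Measurable J) (Θ : Q ≃ᵐ Q) (R : P ≃ᵐ P) (hRneg : ∀ p, R (-p) = -R p)
    (hRadd : ∀ p p', R (p + p') = R p + R p') (he₁ : ∀ p q, e₁ (R p) * Θ q = Θ (e₁ p * q))
    (he₂ : ∀ p q, e₂ (R p) * Θ q = Θ (e₂ p * q)) (he₃ : ∀ p q, e₃ (R p) * Θ q = Θ (e₃ p * q))
    (hgᵥ : ∀ q, gᵥ (Θ q) = R (gᵥ q)) (hgₗ : ∀ q, gₗ (Θ q) = R (gₗ q))
    (hg_c : ∀ q, g_c (Θ q) = R (g_c q))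
    (hFΘ : ∀ q, F (Θ q) = Θ (F q)) (hSΘ : ∀ q, S (Θ q) = S q) (hJΘ : ∀ q, J (Θ q) = J q)
    (hTR : ∀ p, T (R p) = T p) (hRν : MeasurePreserving R ν ν) :
    conjKernel
      (conjKernel
        (refreshUpdate
          (involMH (⇑((flip : Equiv.Perm (Q × P)) *
              omf4Word gᵥ (mulDrift e₁) gₗ (mulDrift e₂) g_c (mulDrift e₃) ^ n)) hΦ
            fun z : Q × P => (S (F z.1) - Real.log (J z.1)) + T z.2)
          ((ν.withDensity (fun q => ENNReal.ofReal (Real.exp (-T q))) Set.univ)⁻¹ •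
            ν.withDensity fun q => ENNReal.ofReal (Real.exp (-T q))))
        F) Θ =
      conjKernel
        (refreshUpdate
          (involMH (⇑((flip : Equiv.Perm (Q × P)) *
              omf4Word gᵥ (mulDrift e₁) gₗ (mulDrift e₂) g_c (mulDrift e₃) ^ n)) hΦ
            fun z : Q × P => (S (F z.1) - Real.log (J z.1)) + T z.2)
          ((ν.withDensity (fun q => ENNReal.ofReal (Real.exp (-T q))) Set.univ)⁻¹ •
            ν.withDensity fun q => ENNReal.ofReal (Real.exp (-T q))))
        F := by
  have hcomm : Function.Commute (⇑((flip : Equiv.Perm (Q × P)) *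
      omf4Word gᵥ (mulDrift e₁) gₗ (mulDrift e₂) g_c (mulDrift e₃) ^ n))
      (fun z : Q × P => (Θ z.1, R z.2)) := by
    rw [Equiv.Perm.coe_mul, Equiv.Perm.coe_pow]
    exact (commute_flip_prodMap (⇑Θ) hRneg).comp_left
      ((commute_omf4Word_prodMap hRadd he₁ he₂ he₃ hgᵥ hgₗ hg_c).iterate_left n)
  exact gauge_fthmc_conjKernel_eq_self_of_commute hS hT F hJm Θ R hcomm hFΘ hSΘ hJΘ hTR hRν

end Kernel

end Summit.Ventures.LatticeQCDFlow.Exactness
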